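import Summits.QuantumAdvantage.QuantumAdvantage.Theorems.PeriodDialB
import HarnessLib

/-!
# PeriodDial (C) — §4b: family P4 (`n ≡ 4 mod 8`, `n ≥ 60`); §5: ★★ `PeriodicFailRes 0 4 2 7`, exactness of the node, the kernel `closes`
(decomp-qadv lens-2 g30; the node memo is the module docstring of part A = `Theorems/PeriodDialA.lean`.)  All proofs complete.
-/

set_option linter.dupNamespace false
set_option linter.style.longLine false

noncomputable section
open scoped Classical

namespace Summit.QuantumAdvantage.QuantumAdvantage.Theorems.PeriodDial
open Finset
open Literature.Computability.QuantumComplexity Literature.Computability.QuantumComplexity.RingHLF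
open Literature.Computability.MetaComplexity Literature.Computability.MetaComplexity.Smolensky
open Summit.QuantumAdvantage.AdviceFreeQNC0 (OddZeros kernel_odd)
open Summit.QuantumAdvantage.AdviceFreeQNC0.Fib19 (IsOdd isOdd_iff_oddZeros kline kline_inKernel kline_hardCore)
open Summit.QuantumAdvantage.AdviceFreeQNC0.LightConeWindowHard
  (window window_apply dot2_eq_zero_of_pairing nxt_val prv_val xor3_eq_false_iff)
open Summit.QuantumAdvantage.QuantumAdvantage.Theorems.LightDial (wt wt_le_of_val_mem lightLosing LightFail)
open Summit.QuantumAdvantage.QuantumAdvantage.Theorems.ParityDial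
  (par IsParityLocal PLocalFail PGlobalFail OGlobalFail ParityUniversalHard closes₃ pLocalFail_two_seven window_eq_of_le window_centre
   parityUniversalHard_two_all not_rel_of_isParityLocal)
open Summit.QuantumAdvantage.QuantumAdvantage.Theses.ExactnessDial (NoPerfectTwo3)

variable {n : ℕ}

/-! ### Family P4 (`n ≡ 4 mod 8`) -/

/-- family P4: the input with ones at `{3, 11, 19, 24, 39, 44, 56}` (weight 7), any length `n`. -/
def xP4 (n : ℕ) : Fin n → Bool := fun j => decide ((j : ℕ) = 3 ∨ (j : ℕ) = 11 ∨ (j : ℕ) = 19 ∨ (j : ℕ) = 24 ∨ (j : ℕ) = 39 ∨ (j : ℕ) = 44 ∨ (j : ℕ) = 56)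
/-- its kernel support: every position except `{4, 6, 8, 10, 20, 22, 24, 26, 28, 30, 32, 34, 36, 38, 45, 47, 49, 51, 53, 55}` (for `n ≡ 4 (mod 8)`, `n ≥ 60`). -/
abbrev VP4 (t : ℕ) : Prop := t ≠ 4 ∧ t ≠ 6 ∧ t ≠ 8 ∧ t ≠ 10 ∧ t ≠ 20 ∧ t ≠ 22 ∧ t ≠ 24 ∧ t ≠ 26 ∧ t ≠ 28 ∧ t ≠ 30 ∧ t ≠ 32 ∧ t ≠ 34 ∧ t ≠ 36 ∧ t ≠ 38 ∧ t ≠ 45 ∧ t ≠ 47 ∧ t ≠ 49 ∧ t ≠ 51 ∧ t ≠ 53 ∧ t ≠ 55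
/-- PeriodDial helper `vP4`: the kernel vector of `xP4` as a Boolean function. -/
def vP4 (n : ℕ) : Fin n → Bool := fun b => decide (VP4 b)
/-- the pairing of `supp vP4`: a table on `[0, 60)` (20 pairs of equal class mod 4 and equal radius-2 window) and the
blocks `t ↦ t ± 4` on the far stretch `[60, n)` (blocks of 8; all windows zero there). -/
def σP4val (t : ℕ) : ℕ :=
  if 60 ≤ t then (if (t - 60) % 8 < 4 then t + 4 else t - 4)
  else if t = 0 then 16
  else if t = 1 then 9
  else if t = 2 then 18
  else if t = 3 then 11
  else if t = 5 then 13
  else if t = 7 then 15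
  else if t = 9 then 1
  else if t = 11 then 3
  else if t = 12 then 40
  else if t = 13 then 5
  else if t = 14 then 50
  else if t = 15 then 7
  else if t = 16 then 0
  else if t = 17 then 37
  else if t = 18 then 2
  else if t = 19 then 39
  else if t = 21 then 41
  else if t = 23 then 43
  else if t = 25 then 57
  else if t = 27 then 31
  else if t = 29 then 33
  else if t = 31 then 27
  else if t = 33 then 29
  else if t = 35 then 59
  else if t = 37 then 17
  else if t = 39 then 19
  else if t = 40 then 12
  else if t = 41 then 21
  else if t = 42 then 54
  else if t = 43 then 23
  else if t = 44 then 56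
  else if t = 46 then 58
  else if t = 48 then 52
  else if t = 50 then 14
  else if t = 52 then 48
  else if t = 54 then 42
  else if t = 56 then 44
  else if t = 57 then 25
  else if t = 58 then 46
  else if t = 59 then 35
  else t
/-- PeriodDial helper `σP4`: the pairing as a map `Fin n → Fin n`. -/
def σP4 (n : ℕ) : Fin n → Fin n := fun b => ⟨min (σP4val b) (n - 1), by have := b.isLt; omega⟩

set_option maxHeartbeats 2000000 in
/-- PeriodDial helper `σP4_val`: the value of the pairing on the support, as a case list. -/
theorem σP4_val (hn : 60 ≤ n) (h8 : n % 8 = 4) (b : Fin n) (hb : vP4 n b = true) :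
    ((b : ℕ) = 0 ∧ ((σP4 n b : Fin n) : ℕ) = 16) ∨
    ((b : ℕ) = 1 ∧ ((σP4 n b : Fin n) : ℕ) = 9) ∨
    ((b : ℕ) = 2 ∧ ((σP4 n b : Fin n) : ℕ) = 18) ∨
    ((b : ℕ) = 3 ∧ ((σP4 n b : Fin n) : ℕ) = 11) ∨
    ((b : ℕ) = 5 ∧ ((σP4 n b : Fin n) : ℕ) = 13) ∨
    ((b : ℕ) = 7 ∧ ((σP4 n b : Fin n) : ℕ) = 15) ∨
    ((b : ℕ) = 9 ∧ ((σP4 n b : Fin n) : ℕ) = 1) ∨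
    ((b : ℕ) = 11 ∧ ((σP4 n b : Fin n) : ℕ) = 3) ∨
    ((b : ℕ) = 12 ∧ ((σP4 n b : Fin n) : ℕ) = 40) ∨
    ((b : ℕ) = 13 ∧ ((σP4 n b : Fin n) : ℕ) = 5) ∨
    ((b : ℕ) = 14 ∧ ((σP4 n b : Fin n) : ℕ) = 50) ∨
    ((b : ℕ) = 15 ∧ ((σP4 n b : Fin n) : ℕ) = 7) ∨
    ((b : ℕ) = 16 ∧ ((σP4 n b : Fin n) : ℕ) = 0) ∨
    ((b : ℕ) = 17 ∧ ((σP4 n b : Fin n) : ℕ) = 37) ∨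
    ((b : ℕ) = 18 ∧ ((σP4 n b : Fin n) : ℕ) = 2) ∨
    ((b : ℕ) = 19 ∧ ((σP4 n b : Fin n) : ℕ) = 39) ∨
    ((b : ℕ) = 21 ∧ ((σP4 n b : Fin n) : ℕ) = 41) ∨
    ((b : ℕ) = 23 ∧ ((σP4 n b : Fin n) : ℕ) = 43) ∨
    ((b : ℕ) = 25 ∧ ((σP4 n b : Fin n) : ℕ) = 57) ∨
    ((b : ℕ) = 27 ∧ ((σP4 n b : Fin n) : ℕ) = 31) ∨
    ((b : ℕ) = 29 ∧ ((σP4 n b : Fin n) : ℕ) = 33) ∨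
    ((b : ℕ) = 31 ∧ ((σP4 n b : Fin n) : ℕ) = 27) ∨
    ((b : ℕ) = 33 ∧ ((σP4 n b : Fin n) : ℕ) = 29) ∨
    ((b : ℕ) = 35 ∧ ((σP4 n b : Fin n) : ℕ) = 59) ∨
    ((b : ℕ) = 37 ∧ ((σP4 n b : Fin n) : ℕ) = 17) ∨
    ((b : ℕ) = 39 ∧ ((σP4 n b : Fin n) : ℕ) = 19) ∨
    ((b : ℕ) = 40 ∧ ((σP4 n b : Fin n) : ℕ) = 12) ∨
    ((b : ℕ) = 41 ∧ ((σP4 n b : Fin n) : ℕ) = 21) ∨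
    ((b : ℕ) = 42 ∧ ((σP4 n b : Fin n) : ℕ) = 54) ∨
    ((b : ℕ) = 43 ∧ ((σP4 n b : Fin n) : ℕ) = 23) ∨
    ((b : ℕ) = 44 ∧ ((σP4 n b : Fin n) : ℕ) = 56) ∨
    ((b : ℕ) = 46 ∧ ((σP4 n b : Fin n) : ℕ) = 58) ∨
    ((b : ℕ) = 48 ∧ ((σP4 n b : Fin n) : ℕ) = 52) ∨
    ((b : ℕ) = 50 ∧ ((σP4 n b : Fin n) : ℕ) = 14) ∨
    ((b : ℕ) = 52 ∧ ((σP4 n b : Fin n) : ℕ) = 48) ∨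
    ((b : ℕ) = 54 ∧ ((σP4 n b : Fin n) : ℕ) = 42) ∨
    ((b : ℕ) = 56 ∧ ((σP4 n b : Fin n) : ℕ) = 44) ∨
    ((b : ℕ) = 57 ∧ ((σP4 n b : Fin n) : ℕ) = 25) ∨
    ((b : ℕ) = 58 ∧ ((σP4 n b : Fin n) : ℕ) = 46) ∨
    ((b : ℕ) = 59 ∧ ((σP4 n b : Fin n) : ℕ) = 35) ∨
    (60 ≤ (b : ℕ) ∧ ((b : ℕ) - 60) % 8 < 4 ∧ ((σP4 n b : Fin n) : ℕ) = (b : ℕ) + 4) ∨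
    (60 ≤ (b : ℕ) ∧ 4 ≤ ((b : ℕ) - 60) % 8 ∧ ((σP4 n b : Fin n) : ℕ) = (b : ℕ) - 4) := by
  have hlt := b.isLt
  simp only [vP4, decide_eq_true_eq] at hb
  simp only [σP4, Fin.val_mk]
  generalize hbt : (b : ℕ) = t at *
  by_cases hT : 60 ≤ t
  · have e : σP4val t = if (t - 60) % 8 < 4 then t + 4 else t - 4 := by unfold σP4val; rw [if_pos hT]
    rw [e]
    split_ifs with hc
    · iterate 40 right
      left; exact ⟨hT, hc, by omega⟩
    · iterate 41 right
      exact ⟨hT, by omega, by omega⟩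
  · interval_cases t <;> first | (exfalso; omega) | (simp [σP4val] <;> omega)

/-- PeriodDial helper `vP4_σP4`: the pairing preserves the support. -/
theorem vP4_σP4 (hn : 60 ≤ n) (h8 : n % 8 = 4) (b : Fin n) (hb : vP4 n b = true) : vP4 n (σP4 n b) = true := by
  have h := σP4_val hn h8 b hb
  have hb' : VP4 b := by simpa only [vP4, decide_eq_true_eq] using hb
  simp only [vP4, decide_eq_true_eq]
  rcases h with h | h | h | h | h | h | h | h | h | h | h | h | h | h | h | h | h | h | h | h | h | h | h | h | h | h | h | h | h | h | h | h | h | h | h | h | h | h | h | h | h | h <;> omega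

/-- PeriodDial helper `cls_σP4`: the pairing preserves the class mod 4. -/
theorem cls_σP4 (hn : 60 ≤ n) (h8 : n % 8 = 4) (b : Fin n) (hb : vP4 n b = true) : cls 4 (σP4 n b) = cls 4 b := by
  have h := σP4_val hn h8 b hb
  simp only [cls]
  rcases h with h | h | h | h | h | h | h | h | h | h | h | h | h | h | h | h | h | h | h | h | h | h | h | h | h | h | h | h | h | h | h | h | h | h | h | h | h | h | h | h | h | h <;> omega

/-- PeriodDial helper `σP4_ne`: the pairing is fixed-point free on the support. -/
theorem σP4_ne (hn : 60 ≤ n) (h8 : n % 8 = 4) (b : Fin n) (hb : vP4 n b = true) : σP4 n b ≠ b := by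
  have h := σP4_val hn h8 b hb
  intro he
  have h' := congrArg Fin.val he
  rcases h with h | h | h | h | h | h | h | h | h | h | h | h | h | h | h | h | h | h | h | h | h | h | h | h | h | h | h | h | h | h | h | h | h | h | h | h | h | h | h | h | h | h <;> omega

/-- PeriodDial helper `σP4_σP4`: the pairing is an involution on the support. -/
theorem σP4_σP4 (hn : 60 ≤ n) (h8 : n % 8 = 4) (b : Fin n) (hb : vP4 n b = true) : σP4 n (σP4 n b) = b := by
  have h1 := σP4_val hn h8 b hb
  have h2 := σP4_val hn h8 (σP4 n b) (vP4_σP4 hn h8 b hb)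
  apply Fin.ext
  rcases h1 with h | h | h | h | h | h | h | h | h | h | h | h | h | h | h | h | h | h | h | h | h | h | h | h | h | h | h | h | h | h | h | h | h | h | h | h | h | h | h | h | h | h <;> omega

set_option maxHeartbeats 4000000 in
/-- PeriodDial helper `window_σP4`: the pairing preserves the radius-2 window of `xP4`. -/
theorem window_σP4 (hn : 60 ≤ n) (h8 : n % 8 = 4) (b : Fin n) (hb : vP4 n b = true) :
    window 2 (xP4 n) (σP4 n b) = window 2 (xP4 n) b := by
  have h := σP4_val hn h8 b hb
  have hlt := b.isLt
  funext d
  have hd := d.isLt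
  rw [window_apply 2 (by omega), window_apply 2 (by omega)]
  simp only [xP4, decide_eq_decide]
  generalize hs : ((σP4 n b : Fin n) : ℕ) = s at *
  generalize hdd : (d : ℕ) = dd at *
  generalize ht : (b : ℕ) = t at *
  interval_cases dd <;>
  · rcases h with ⟨rfl, rfl⟩ | ⟨rfl, rfl⟩ | ⟨rfl, rfl⟩ | ⟨rfl, rfl⟩ | ⟨rfl, rfl⟩ | ⟨rfl, rfl⟩ | ⟨rfl, rfl⟩ | ⟨rfl, rfl⟩ | ⟨rfl, rfl⟩ | ⟨rfl, rfl⟩ | ⟨rfl, rfl⟩ | ⟨rfl, rfl⟩ | ⟨rfl, rfl⟩ | ⟨rfl, rfl⟩ | ⟨rfl, rfl⟩ | ⟨rfl, rfl⟩ | ⟨rfl, rfl⟩ | ⟨rfl, rfl⟩ | ⟨rfl, rfl⟩ | ⟨rfl, rfl⟩ | ⟨rfl, rfl⟩ | ⟨rfl, rfl⟩ | ⟨rfl, rfl⟩ | ⟨rfl, rfl⟩ | ⟨rfl, rfl⟩ | ⟨rfl, rfl⟩ | ⟨rfl, rfl⟩ | ⟨rfl, rfl⟩ | ⟨rfl, rfl⟩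 | ⟨rfl, rfl⟩ | ⟨rfl, rfl⟩ | ⟨rfl, rfl⟩ | ⟨rfl, rfl⟩ | ⟨rfl, rfl⟩ | ⟨rfl, rfl⟩ | ⟨rfl, rfl⟩ | ⟨rfl, rfl⟩ | ⟨rfl, rfl⟩ | ⟨rfl, rfl⟩ | ⟨rfl, rfl⟩ | ⟨hT, hm, rfl⟩ | ⟨hT, hm, rfl⟩
    all_goals first
      | ((try simp (disch := omega) only [if_pos, if_neg, true_or, or_true]) <;> omega)
      | (split_ifs <;> ((try simp) <;> omega))

/-- PeriodDial helper `inKernel_vP4`: `vP4` is a kernel vector of `xP4` (`n ≥ 60`). -/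
theorem inKernel_vP4 (hn : 60 ≤ n) : InKernel (xP4 n) (vP4 n) := by
  intro b
  rw [xor3_eq_false_iff]
  have hb := b.isLt
  simp only [vP4, xP4, Bool.and_eq_true, decide_eq_true_eq, ne_eq, decide_eq_decide, prv_val, nxt_val]
  split_ifs <;> omega

/-- PeriodDial helper `edgesIn_vP4`: the support has `n − 40` inner edges. -/
theorem edgesIn_vP4 (hn : 60 ≤ n) : edgesIn (vP4 n) = n - 40 := by
  unfold edgesIn
  have h : (univ.filter fun b : Fin n => vP4 n b = true ∧ vP4 n (nxt b) = true)
      = univ \ ({3, 4, 5, 6, 7, 8, 9, 10, 19, 20, 21, 22, 23, 24, 25, 26, 27, 28, 29, 30, 31, 32, 33, 34, 35, 36, 37, 38, 44, 45, 46, 47, 48, 49, 50, 51, 52, 53, 54, 55} : Finset ℕ).attachFin (by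
          intro t ht; simp only [mem_insert, mem_singleton] at ht; omega) := by
    ext b
    have hb := b.isLt
    simp only [mem_filter, mem_univ, true_and, mem_sdiff, mem_attachFin, vP4, decide_eq_true_eq, nxt_val, mem_insert,
      mem_singleton]
    split_ifs <;> omega
  have hc : ({3, 4, 5, 6, 7, 8, 9, 10, 19, 20, 21, 22, 23, 24, 25, 26, 27, 28, 29, 30, 31, 32, 33, 34, 35, 36, 37, 38, 44, 45, 46, 47, 48, 49, 50, 51, 52, 53, 54, 55} : Finset ℕ).card = 40 := by rfl
  rw [h, card_sdiff_of_subset (subset_univ _), card_attachFin, card_univ, Fintype.card_fin, hc]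

/-- PeriodDial helper `wtAnd_xP4`: `6` ones of `xP4` lie in the support. -/
theorem wtAnd_xP4 (hn : 60 ≤ n) : wtAnd (xP4 n) (vP4 n) = 6 := by
  unfold wtAnd
  have h : (univ.filter fun b : Fin n => xP4 n b = true ∧ vP4 n b = true)
      = ({3, 11, 19, 39, 44, 56} : Finset ℕ).attachFin (by intro t ht; simp only [mem_insert, mem_singleton] at ht; omega) := by
    ext b
    have hb := b.isLt
    simp only [mem_filter, mem_univ, true_and, mem_attachFin, vP4, xP4, decide_eq_true_eq, mem_insert, mem_singleton]
    omega
  have hc : ({3, 11, 19, 39, 44, 56} : Finset ℕ).card = 6 := by rfl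
  rw [h, card_attachFin, hc]

/-- PeriodDial helper `signBit_xP4`: the sign bit of the certificate is `1` (`n ≡ 4 (mod 8)`, `n ≥ 60`). -/
theorem signBit_xP4 (hn : 60 ≤ n) (h8 : n % 8 = 4) : signBit (xP4 n) (vP4 n) = 1 := by
  unfold signBit; rw [edgesIn_vP4 hn, wtAnd_xP4 hn]; omega

/-- PeriodDial helper `card_zeros_xP4`: `xP4` has `n − 7` zeros. -/
theorem card_zeros_xP4 (hn : 60 ≤ n) : (univ.filter fun b : Fin n => xP4 n b = false).card = n - 7 := by
  have h : (univ.filter fun b : Fin n => xP4 n b = false)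
      = univ \ ({3, 11, 19, 24, 39, 44, 56} : Finset ℕ).attachFin (by
          intro t ht; simp only [mem_insert, mem_singleton] at ht; omega) := by
    ext b
    simp only [mem_filter, mem_univ, true_and, mem_sdiff, mem_attachFin, xP4, decide_eq_false_iff_not, mem_insert,
      mem_singleton]
  have hc : ({3, 11, 19, 24, 39, 44, 56} : Finset ℕ).card = 7 := by rfl
  rw [h, card_sdiff_of_subset (subset_univ _), card_attachFin, card_univ, Fintype.card_fin, hc]

/-- PeriodDial helper `oddZeros_xP4`: `xP4` lies in the odd class when `n` is even (`n ≥ 60`). -/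
theorem oddZeros_xP4 (hn : 60 ≤ n) (h8 : n % 8 = 4) : OddZeros (xP4 n) := by
  unfold OddZeros; rw [card_zeros_xP4 hn]; omega

/-- PeriodDial helper `wt_xP4`: `xP4` is LIGHT — weight `≤ 7`. -/
theorem wt_xP4 (n : ℕ) : wt (xP4 n) ≤ 7 :=
  wt_le_of_val_mem [3, 11, 19, 24, 39, 44, 56] fun j hj => by
    simp only [xP4, decide_eq_true_eq] at hj
    simp only [List.mem_cons, List.not_mem_nil, or_false]
    omega

/-- ★ FAMILY P4 IS PERIOD-4-UNIVERSAL-HARD at radius 2: for every `n ≡ 4 (mod 8)`, `n ≥ 60`, the weight-7 input `xP4 n` defeats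
EVERY 4-periodic rule table of radius 2 (hence every such rule with any input-global advice, `periodicUniversalHard_any_advice`). -/
theorem xP4_periodicUniversalHard (hn : 60 ≤ n) (h8 : n % 8 = 4) : PeriodicUniversalHard 4 2 (xP4 n) :=
  periodicUniversalHard_of_pairing 4 2 (xP4 n) (vP4 n) (σP4 n) (oddZeros_xP4 hn h8) (inKernel_vP4 hn)
    (signBit_xP4 hn h8) (vP4_σP4 hn h8) (window_σP4 hn h8) (cls_σP4 hn h8) (σP4_ne hn h8) (σP4_σP4 hn h8)


/-! ## §5 ★★ The special piece `PeriodicFailRes 0 4 2 7` is a theorem; exactness of the node; the kernel onto the leaf and onto `NoPerfectTwo3` -/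

/-- every `n ≡ 0 (mod 4)`, `n ≥ 60`, carries a weight-7 period-4-universal-hard input of radius 2. -/
theorem periodicUniversalHard_four_two_all (n : ℕ) (hn : 60 ≤ n) (h4 : n % 4 = 0) :
    ∃ x : Fin n → Bool, wt x ≤ 7 ∧ PeriodicUniversalHard 4 2 x := by
  rcases Nat.even_or_odd (n / 4) with ⟨k, hk⟩ | ⟨k, hk⟩
  · exact ⟨xP0 n, wt_xP0 n, xP0_periodicUniversalHard (by omega) (by omega)⟩
  · exact ⟨xP4 n, wt_xP4 n, xP4_periodicUniversalHard (by omega) (by omega)⟩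

/-- ★★ THE SPECIAL PIECE IS A THEOREM at residue 0, period 4, radius 2, weight 7 (degree-free). -/
theorem periodicFailRes_zero_four_two_seven : PeriodicFailRes 0 4 2 7 :=
  periodicFailRes_of_universal ⟨60, fun n hn h4 => periodicUniversalHard_four_two_all n hn h4⟩

/-- … hence at radius 1 (and 0). -/
theorem periodicFailRes_zero_four_one_seven : PeriodicFailRes 0 4 1 7 :=
  periodicFailRes_anti_radius (by norm_num) periodicFailRes_zero_four_two_seven

/-- by-product: the period-4 inputs re-prove ParityDial's radius-2 special piece on `n ≡ 0 (mod 4)` from `n ≥ 60` (there: `n ≥ 72`). -/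
theorem parityUniversalHard_two_of_four (n : ℕ) (hn : 60 ≤ n) (h4 : n % 4 = 0) :
    ∃ x : Fin n → Bool, wt x ≤ 7 ∧ ParityUniversalHard 2 x := by
  obtain ⟨x, hw, hx⟩ := periodicUniversalHard_four_two_all n hn h4
  exact ⟨x, hw, parityUniversalHard_of_periodic (by norm_num) hx⟩

/-- ★ EXACTNESS OF THE NODE on `n ≡ 0 (mod 4)`: the leaf-residue IS the period-4 generic piece (every degree `D`). -/
theorem pGlobalFailRes_zero_iff_aperiodic (D : ℕ) : PGlobalFailRes 0 2 D 7 ↔ AperiodicFailRes 0 4 2 D 7 :=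
  ⟨aperiodicFailRes_of_res (by norm_num), pGlobalFailRes_of_period periodicFailRes_zero_four_two_seven⟩

/-- ★ NODE (EQUIV): the generic leaf `PGlobalFail 2 2 7` ⟺ (period-4 generic piece on `n ≡ 0 mod 4`) ∧ (the leaf on `n ≡ 2 mod 4`). -/
theorem leaf_iff_pieces : PGlobalFail 2 2 7 ↔ AperiodicFailRes 0 4 2 2 7 ∧ PGlobalFailRes 2 2 2 7 := by
  rw [pGlobalFail_iff_res, pGlobalFailRes_zero_iff_aperiodic]

/-- ★ KERNEL onto the generic leaf BY NAME: `AperiodicFailRes 0 4 2 2 7 → PGlobalFailRes 2 2 2 7 → ParityDial.PGlobalFail 2 2 7`. -/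
theorem closes_leaf (hA : AperiodicFailRes 0 4 2 2 7) (h2 : PGlobalFailRes 2 2 2 7) : PGlobalFail 2 2 7 :=
  leaf_iff_pieces.mpr ⟨hA, h2⟩

/-- ★ KERNEL onto ExactnessDial's `NoPerfectTwo3` (stmt-QuantumAdvantage-27432) BY NAME, via ParityDial's `closes₃`. -/
theorem closes (hA : AperiodicFailRes 0 4 2 2 7) (h2 : PGlobalFailRes 2 2 2 7) (hO : OGlobalFail 2 2 7) : NoPerfectTwo3 :=
  closes₃ (closes_leaf hA h2) hO

end Summit.QuantumAdvantage.QuantumAdvantage.Theorems.PeriodDial
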